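import Mathlib
import Summits.Ventures.HodgeRepro2.Tier7.Line1.Defs

/-!
# Tier 7 — LINE 1: the `U(W)` interface (`Line1/TwoTorus.lean`; imports `Line1/Defs.lean`)

§6 `TwoTorusData` (seesaw descent of the two Hecke modules to constituents of the rank-two group `U(W)`, Kudla 1984)
with `TwoTorus ↔ CommonIrred` on the tautological data; §7 `TransportData` (transport by `g ∈ GU(W)(F)` of similitude
factor `u`, TIER5 N0.3 (D1); Tunnell–Saito sign compatibility `swapOK` on the swap set `S = S_g ∪ {ι_2}`), the
local-global form `TwoTorusLocal ↔ TwoTorus`, the obstruction shape `not_two_torus_of_no_swapOK`; §5′ the `U(W)`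
clothing of the residual, `R_TwoTorus ↔ R_CommonIrred` (a theorem: the interface adds no axiom, crit-1 l. 14626
O2(a)), and the sorry-free deliverable `p_T7_of_residual_two_torus`. Sorry-free; no field of the frozen target is
restated. -/

namespace Summit.Ventures.HodgeRepro2.Tier7.Line1

open Summit.Ventures.HodgeRepro2.Tier7

section

variable {K : Type} [Field K] [NumberField K] {E' : Type} [Field E'] [NumberField E']
  {V : Type} [AddCommGroup V] [Module E' V] {HX : Type} [Ring HX] [Algebra ℂ HX]
  {G : Type} [Group G] [MulAction G HX] (D : PeriodDatum K E' V HX G)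

/-! ## 6. The crux cut to the rank-two group `U(W)` (printed inputs DISPLAYED; the residual named) -/

/-- The `U(W)`-side reading of `CommonIrred` (every field is a PRINTED fact about the real objects, with its
locator in proofs/t7/INPUTS.md; nothing here is the step): `Cons` = the irreducible automorphic constituents of
the CM part of `U(W)` (`W = W_0 ⊕ W_1 ≅ W_2 ⊕ W_3`, (H12)); `desc σ` = the Hecke-irreducible submodule of
`H^{2,0}(X_∞)` that `σ` descends to (Howe duality + Liu 2021 Prop 4.13); `PA σ` = «the `(T, χ_A)`-period of `σ`
is non-zero», `PB σ` = «the `(g⁻¹Tg, χ_B^g)`-period of `σ` is non-zero» (`g ∈ GU(W)(F)` of similitude factor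
`u = disc 2·disc 3/(disc 0·disc 1)`); `seesawA` = Kudla 1984 seesaw for `(U(V), U(W)) ⊃ (U(V), T)`; `seesawB` = the
same seesaw for `ψ_u` + multiplicity one on `U(W)` (Rogawski 1990, Ch. 11 / Labesse–Langlands 1979), which makes
`θ^{ψ_u}(Π) = θ^ψ(Π)^g` as spaces; `desc_surj` = every constituent of `P_A` is a theta descent (Howe duality). -/
structure TwoTorusData where
  Cons : Type
  PA : Cons → Prop
  PB : Cons → Prop
  desc : Cons → Submodule ℂ HX
  desc_irred : ∀ σ, HeckeIrred G (desc σ)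
  seesawA : ∀ σ, PA σ ↔ desc σ ≤ prodModS D
  seesawB : ∀ σ, PB σ ↔ desc σ ≤ prodModSbar D
  desc_surj : ∀ W : Submodule ℂ HX, W ≤ prodModS D → HeckeIrred G W → ∃ σ, desc σ = W

/-- THE RESIDUAL OF LINE 1, stated on `U(W)`: one constituent `σ` has non-zero periods along BOTH
`GU(W)`-conjugate tori (`T, χ_A`) and (`g⁻¹Tg, χ_B^g`). Why the line bets on it: the two tori are locally
conjugate outside the EVEN set `S_g ∪ {ι_2}` (TIER5 N0.3: `S_g` odd), so the two local Tunnell–Saito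
dichotomies can be met by one `σ`; what is missing in print is the GLOBAL existence — the part of (P) beyond
(H1)–(H12) that the counter-model (crit-1 l. 14584) shows no frozen field supplies. -/
def TwoTorus (T : TwoTorusData D) : Prop := ∃ σ, T.PA σ ∧ T.PB σ

/-- (PROVED) the two-torus statement gives the crux: `W = W' = desc σ`, `φ` = the inclusion. -/
theorem common_irred_of_two_torus (T : TwoTorusData D) (h : TwoTorus D T) : CommonIrred D := by
  obtain ⟨σ, hA, hB⟩ := h
  refine ⟨T.desc σ, T.desc σ, T.desc_irred σ, T.desc_irred σ, (T.seesawA σ).mp hA, (T.seesawB σ).mp hB,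
    (T.desc σ).subtype, fun x => x.2, fun _ _ => rfl, ?_⟩
  intro h0
  obtain ⟨x, hx, hxne⟩ := (Submodule.ne_bot_iff _).mp (T.desc_irred σ).1
  have hx0 := congrArg (fun f : T.desc σ →ₗ[ℂ] HX => f ⟨x, hx⟩) h0
  simp at hx0
  exact hxne hx0

/-- (PROVED) conversely the crux forces the two-torus statement through `desc_surj` + (H10): the residual is
EXACTLY the crux in `U(W)` clothing — no content is hidden in the interface. -/
theorem two_torus_of_common_irred (T : TwoTorusData D) (hc : CommonIrred D) : TwoTorus D T := by
  obtain ⟨W, W', hW, hW', hWA, hWB, φ, hφ, hφeq, hφne⟩ := hc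
  have hEq : W = W' :=
    D.S.H20_multone W W' (hWA.trans (prodModS_le D)) (hWB.trans (prodModSbar_le D)) hW hW' φ hφ hφeq hφne
  obtain ⟨σ, hσ⟩ := T.desc_surj W hWA hW
  refine ⟨σ, (T.seesawA σ).mpr (hσ ▸ hWA), (T.seesawB σ).mpr ?_⟩
  rw [hσ, hEq]
  exact hWB

/-! ## 7. The refined cut (for t7-L1-p1..p5): transport, local sign compatibility, the residual in its local-global form
(v2 — v1's `gstable`/`dichotomy` was FALSE of the real datum: the transport factor `u` is negative at an indefinite real
place, where `Ad(g)` swaps holomorphic and antiholomorphic discrete series, so NO `σ` of the forced weight is `g`-stable;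
the true local statement is Tunnell–Saito SIGN COMPATIBILITY on the swap set, below.) -/

/-- `U(W)`-side refinement of `TwoTorusData` (every field a PRINTED fact about the real objects, locators in
proofs/t7/INPUTS.md): `tw σ` = the `GU(W)(F)`-conjugate `σ ∘ Ad(g⁻¹)` for `g ∈ GU(W)(F)` of similitude factor `u`
(TIER5 N0.3 (D1): `e_{101} = u e_{111}`, `e_{110} = u⁻¹ e_{100}`, `ι_1(u) > 0`, `ι_2(u) < 0`, `ι_3(u) > 0`); `PA' σ` =
«the `(T, χ_B')`-period of `σ` is non-zero», `χ_B' = (μ_2 ⊠ μ_3) ∘ Ad(g)` on `T`; `PB_iff` = the change of variables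
`P_{T'}(σ, χ_B) = P_T(σ ∘ Ad(g⁻¹), χ_B')`; `tw_tw` = `Ad(g²)` is inner (`u² ∈ N(E'^×)`) + multiplicity one on `U(W)`
(Rogawski 1990 Ch. 11 / Labesse–Langlands 1979); `swapOK σ` = Tunnell–Saito sign compatibility: on the SWAP SET
`S = {v : η_v(u) = −1} = S_g ∪ {ι_2}` (even, TIER5 N0.3: `|S_g|` odd) the member of the local packet of `σ_v` carrying
the `(T_v, χ_{A,v})`-functional is the `Ad(g_v)`-swap of the member carrying `(T_v, χ_{B',v})`, and off `S` the same
member carries both (no condition where the packet is a singleton) — `swapOK_of_periods` = Tunnell 1983 / Saito 1993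
applied at every place to both periods; `central σ` = `ω_σ · μ_0μ_1 = 1 = ω_σ · μ_2μ_3` on `E'^1`, `central_of_periods`
= the centre acts by a scalar on `σ` and on the period functionals (hence (H11b)). -/
structure TransportData (T : TwoTorusData D) where
  tw : T.Cons → T.Cons
  PA' : T.Cons → Prop
  PB_iff : ∀ σ, T.PB σ ↔ PA' (tw σ)
  tw_tw : ∀ σ, tw (tw σ) = σ
  swapOK : T.Cons → Prop
  swapOK_of_periods : ∀ σ, T.PA σ → T.PB σ → swapOK σ
  central : T.Cons → Prop
  central_of_periods : ∀ σ, T.PA σ → T.PB σ → central σ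

/-- THE RESIDUAL in its LOCAL-GLOBAL form: a constituent `σ` satisfying the local sign compatibility and the central
condition, with `P_T(σ, χ_A) ≠ 0` and `P_T(σ ∘ Ad(g⁻¹), χ_B') ≠ 0`. -/
def TwoTorusLocal (T : TwoTorusData D) (R : TransportData D T) : Prop :=
  ∃ σ, R.swapOK σ ∧ R.central σ ∧ T.PA σ ∧ R.PA' (R.tw σ)

/-- (PROVED) the local-global form is the two-torus statement, both ways: the local conditions are NECESSARY
(Tunnell–Saito, the centre), so nothing is lost by imposing them — and they are where the L-value-free analysis lives. -/
theorem two_torus_iff_local (T : TwoTorusData D) (R : TransportData D T) :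
    TwoTorus D T ↔ TwoTorusLocal D T R := by
  constructor
  · rintro ⟨σ, hA, hB⟩
    exact ⟨σ, R.swapOK_of_periods σ hA hB, R.central_of_periods σ hA hB, hA, (R.PB_iff σ).mp hB⟩
  · rintro ⟨σ, _, _, hA, hA'⟩
    exact ⟨σ, hA, (R.PB_iff σ).mpr hA'⟩

/-- (PROVED) the OBSTRUCTION shape: if no constituent is sign-compatible (a wrong swap-set parity), the two-torus
statement — hence the crux — is FALSE; the cell's datum has the right parity by Tier 5's tuning (N0.3 (D1)–(D3)). -/
theorem not_two_torus_of_no_swapOK (T : TwoTorusData D) (R : TransportData D T)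
    (h : ∀ σ, ¬ R.swapOK σ) : ¬ TwoTorus D T := by
  rintro ⟨σ, hA, hB⟩
  exact h σ (R.swapOK_of_periods σ hA hB)

/-- (PROVED) the transport is compatible with `PB` on the `tw`-side: `PB (tw σ) ↔ PA' σ` -/
theorem PB_tw_iff (T : TwoTorusData D) (R : TransportData D T) (σ : T.Cons) :
    T.PB (R.tw σ) ↔ R.PA' σ := by
  rw [R.PB_iff, R.tw_tw]

/-- (PROVED) the residual reaches the target through the whole chain -/
theorem target_of_local (T : TwoTorusData D) (R : TransportData D T) (h : TwoTorusLocal D T R) :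
    ∃ g : Fin 4 → G, D.S.L2 (D.fOmegaS g) (D.fOmegaSbar g) ≠ 0 :=
  exists_pairing_ne_zero_of_inf_ne_bot D
    (inf_ne_bot_of_common_irred D (common_irred_of_two_torus D T ((two_torus_iff_local D T R).mpr h)))

/-- the TAUTOLOGICAL `TwoTorusData` (sanity: the interface is inhabited over every datum, so it carries no axiom by
itself — its teeth are the IDENTIFICATION of `Cons` with the automorphic spectrum of `U(W)` in INPUTS.md) -/
def tautTwoTorusData : TwoTorusData D where
  Cons := {W : Submodule ℂ HX // HeckeIrred G W}
  PA := fun W => (W : Submodule ℂ HX) ≤ prodModS D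
  PB := fun W => (W : Submodule ℂ HX) ≤ prodModSbar D
  desc := fun W => W
  desc_irred := fun W => W.2
  seesawA := fun _ => Iff.rfl
  seesawB := fun _ => Iff.rfl
  desc_surj := fun W _ hW => ⟨⟨W, hW⟩, rfl⟩

/-- (PROVED) on the tautological data the two-torus statement is literally `CommonIrred` -/
theorem taut_two_torus_iff : TwoTorus D (tautTwoTorusData D) ↔ CommonIrred D :=
  ⟨fun h => common_irred_of_two_torus D _ h, fun h => two_torus_of_common_irred D _ h⟩

/-! ## 5′. The residual in `U(W)` clothing -/

/-- the residual `R_CommonIrred` in `U(W)` clothing: a `TwoTorusData` with a two-torus constituent -/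
def R_TwoTorus : Prop :=
  ∀ (K : Type) [Field K] [NumberField K] (E' : Type) [Field E'] [NumberField E']
    (V : Type) [AddCommGroup V] [Module E' V] (HX : Type) [Ring HX] [Algebra ℂ HX]
    (G : Type) [Group G] [MulAction G HX] (D : PeriodDatum K E' V HX G),
    ∃ T : TwoTorusData D, TwoTorus D T

/-- (PROVED) the `U(W)` clothing adds no axiom: `R_TwoTorus ↔ R_CommonIrred` (crit-1 l. 14626 O2(a)) -/
theorem R_TwoTorus_iff : R_TwoTorus ↔ R_CommonIrred := by
  constructor
  · intro h K _ _ E' _ _ V _ _ HX _ _ G _ _ D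
    obtain ⟨T, hT⟩ := h K E' V HX G D
    exact common_irred_of_two_torus D T hT
  · intro h K _ _ E' _ _ V _ _ HX _ _ G _ _ D
    exact ⟨tautTwoTorusData D, two_torus_of_common_irred D _ (h K E' V HX G D)⟩

/-- **DELIVERABLE, `U(W)` form (sorry-free)**: `R_TwoTorus → P_T7`. -/
theorem p_T7_of_residual_two_torus (h : R_TwoTorus) : P_T7 :=
  p_T7_of_residual (R_TwoTorus_iff.mp h)

end

end Summit.Ventures.HodgeRepro2.Tier7.Line1
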